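import Mathlib.RingTheory.DedekindDomain.IntegralClosure
import Summits.BirchSwinnertonDyer.BirchSwinnertonDyer.Theorems.ResidualThetaTransportAtTwoLambdaLowerBoundOWeierstrass
import Summits.BirchSwinnertonDyer.BirchSwinnertonDyer.Theorems.ResidualThetaTransportAtTwoLambdaLowerBoundOHerbrand
import HarnessLib

/-!
# Route `SignedLowerHalves`, crux L `SmallImageLowerHalfBothSigns` (item stmt-BirchSwinnertonDyer-23599), line `rtt_w3` —
# row **E2-num** of `Lines/rtt_w3-BRIEF-E2-g8.md` §2, part 2: the λ-count of `Λ_𝒪/(L)` in the crux's `ℤ_p`-CURRENCY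
# `λ(M) = dim_{ℚ_p}(ℚ_p ⊗_{ℤ_p} M)` (= `lambdaInvariant p`): `= [E:ℚ_p]·d` for the norm-λ index `d` of `L`; the
# `ℤ_p ↔ 𝒪` bridge `dim_{ℚ_p}(ℚ_p ⊗_{ℤ_p} M) = [E:ℚ_p]·dim_E(E ⊗_𝒪 M)` for `M` finitely generated over `𝒪 = 𝒪_E`; and the
# norm-λ WITNESS of every non-zero `L ∈ 𝒪⟦T⟧` (any `p`)

Width seat `bsd-line-slh-p3-w3` g19 under LEAD `cruxlead-stmt-BirchSwinnertonDyer-23599` g8 (cell `bsd-ssimc`); ROUTE-INDEPENDENT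
helper (`--supports stmt-BirchSwinnertonDyer-23599`); THEOREMS ONLY — no definition, no named fact, no instance, no `sorry`;
pure commutative algebra; closes nothing; BSD is not proved by any of this.

WHY. The E2-tail of `stub_charRoad_ns` bounds `lambdaInvariant p Dψ.X = dim_{ℚ_p}(ℚ_p ⊗_{ℤ_p} Dψ.X)` (the tree's `ℤ_p`-currency)
from below by `[F:ℚ_p]·(d + Σ_v …)`, while the module theory of `Λ_𝒪 = 𝒪⟦T⟧`-modules that the LEAD's cut E2-PT/E2-K/E2-an runs
through (BRIEF-E2 rev 2 §3) is most naturally — and in the tree already IS (route RTT@2's `…Theorems.LambdaLowerBoundO*`) —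
written in the `𝒪`-currency `dim_E(E ⊗_𝒪 M)`. This file supplies the two conversions the §3 chain needs, on the carrier
`𝒪 = PadicIntermediateField.unitBall p E` (`E/ℚ_p` finite; `= padicCoeffIntegers S` for `E = padicCoeffField S` by
`padicCoeffIntegers_eq_unitBall`), where the `ℤ_p`-structures are the canonical ones (`Algebra ℤ_[p] (unitBall p E)`, scalar
towers through `𝒪⟦T⟧` and its quotients):

* §1 `exists_dvd_natCast_prime_pow` — every non-zero `c ∈ 𝒪_E` divides a power of `p` (and `rk_{ℤ_p} 𝒪_E = [E:ℚ_p]` is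
  Mathlib's `IsIntegralClosure.rank`, as in the tree's `SmallImageRttCharRoad.finrank_padicInt_unitBall_eq`).
* §2 **`finrank_padic_baseChange_quotient_span_eq_mul_of_normLambda`** — for `L ∈ 𝒪⟦T⟧`, `L ≠ 0`, with the stub's two norm
  clauses at `d`: `dim_{ℚ_p}(ℚ_p ⊗_{ℤ_p} 𝒪⟦T⟧/(L)) = [E:ℚ_p]·d`, WHATEVER `μ(L)` (the `𝒪`-twin `dim_E(E ⊗_𝒪 𝒪⟦T⟧/(L)) = d` is
  RTT@2's `LambdaLowerBoundO.finrank_baseChange_quotient_span_eq_of_normLambda`, p625410; same proof: `L = C(c)·L₀`,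
  `𝒪⟦T⟧/(L₀)` free of rank `d` by Weierstrass preparation, the kernel of `𝒪⟦T⟧/(L) ↠ 𝒪⟦T⟧/(L₀)` is killed by `c ∣ p^N`).
* §3 **`finrank_padic_baseChange_eq_mul_of_moduleFinite`** — for `M` finitely generated over `𝒪_E`:
  `dim_{ℚ_p}(ℚ_p ⊗_{ℤ_p} M) = [E:ℚ_p]·dim_E(E ⊗_{𝒪_E} M)` (torsion is finite, `M/M_tors` is free; RTT@2's
  `finrank_baseChange_eq_finrank_quotientTorsion`, `finite_torsion_unitBall`).
* §4 **`exists_normLambda_unitBall`** / **`exists_normLambda_iwasawaAlgebraO`** — every non-zero `L ∈ 𝒪⟦T⟧` HAS a norm-λ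
  index `d` (the coefficient norms lie in the discrete set `‖ϖ‖^ℕ ∪ {0}`; port of RTT@2's `p = 2` witness
  `ResidualThetaLayer.stub_normLambdaWitnessAtTwo` to every `p`), the `∃ d` the E2-tail asks for.

References: [Washington1997] §7.1 Thm. 7.3, §13.2; [NeukirchANT1999] Ch. II (4.8).
-/

set_option autoImplicit false
-- the Theorems namespace of this sub repeats the summit name by design (D-0017 nested layout)
set_option linter.dupNamespace false

noncomputable section

open scoped TensorProduct

open PowerSeries Literature.NumberTheory.Automorphic
open Summit.BirchSwinnertonDyer.BirchSwinnertonDyer.Theorems.LambdaLowerBoundO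

namespace Summit.BirchSwinnertonDyer.BirchSwinnertonDyer.Theorems.SmallImageRttE2Num

universe w

variable (p : ℕ) [Fact p.Prime] (E : IntermediateField ℚ_[p] (PadicAlgCl p))

/-! ## §1. `𝒪_E`: non-zero elements divide a power of `p` -/

/-- **Every non-zero `c ∈ 𝒪_E` divides a power of `p`** (`‖p‖^N ≤ ‖c‖` for `N` large, and `‖x‖ ≤ ‖y‖ ⇒ y ∣ x` in the
unit ball). [cite: NeukirchANT1999, Ch. II (4.8)] -/
theorem exists_dvd_natCast_prime_pow {c : PadicIntermediateField.unitBall p E} (hc : c ≠ 0) :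
    ∃ N : ℕ, c ∣ ((p : ℕ) : PadicIntermediateField.unitBall p E) ^ N := by
  have hcpos : 0 < ‖(c : PadicAlgCl p)‖ := norm_pos_iff.mpr fun h ↦ hc (Subtype.ext h)
  have hp1 : ‖((p : ℕ) : PadicAlgCl p)‖ < 1 := by
    rw [show ((p : ℕ) : PadicAlgCl p) = algebraMap ℚ_[p] (PadicAlgCl p) (p : ℚ_[p]) by simp,
      PadicAlgCl.norm_extends]
    exact Padic.norm_p_lt_one
  obtain ⟨N, hN⟩ := exists_pow_lt_of_lt_one hcpos hp1
  refine ⟨N, dvd_of_norm_le p E ?_ hc⟩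
  rw [SubmonoidClass.coe_pow, norm_pow]
  exact hN.le

variable [FiniteDimensional ℚ_[p] E]

/-! ## §2. `dim_{ℚ_p}(ℚ_p ⊗_{ℤ_p} 𝒪⟦T⟧/(L)) = [E:ℚ_p]·d` for the norm-λ index `d` of `L` -/

/-- `𝒪_E⟦T⟧/(L₀)` is free over `ℤ_p` of rank `[E:ℚ_p]·d` when `ord(L₀ mod 𝔪) = d`. [cite: Washington1997, §7.1 Thm. 7.3] -/
theorem free_finrank_padicInt_quotient_span_of_order_eq (L₀ : PowerSeries (PadicIntermediateField.unitBall p E))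
    (d : ℕ) (hord : (L₀.map (IsLocalRing.residue (PadicIntermediateField.unitBall p E))).order = d) :
    Module.Free ℤ_[p] (PowerSeries (PadicIntermediateField.unitBall p E) ⧸ Ideal.span {L₀}) ∧
      Module.finrank ℤ_[p] (PowerSeries (PadicIntermediateField.unitBall p E) ⧸ Ideal.span {L₀}) =
        Module.finrank ℚ_[p] E * d := by
  obtain ⟨hfree, hfin, hrank⟩ := free_finrank_quotient_span_of_order_eq p E L₀ d hord
  haveI := hfree
  haveI := hfin
  haveI : Module.Free ℤ_[p] (PowerSeries (PadicIntermediateField.unitBall p E) ⧸ Ideal.span {L₀}) :=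
    Module.Free.trans (S := PadicIntermediateField.unitBall p E)
  refine ⟨inferInstance, ?_⟩
  rw [← Module.finrank_mul_finrank ℤ_[p] (PadicIntermediateField.unitBall p E)
    (PowerSeries (PadicIntermediateField.unitBall p E) ⧸ Ideal.span {L₀}),
    IsIntegralClosure.rank ℤ_[p] ℚ_[p] E (PadicIntermediateField.unitBall p E), hrank]

/-- **E2-num, module side, `ℤ_p`-currency.** For `L ∈ 𝒪_E⟦T⟧`, `L ≠ 0`, and `d` satisfying the stub's two norm clauses
(`‖L_k‖ ≤ ‖L_d‖` for all `k`, `<` for `k < d`, norms read in `ℚ̄_p`):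
`dim_{ℚ_p}(ℚ_p ⊗_{ℤ_p} 𝒪_E⟦T⟧/(L)) = [E:ℚ_p]·d` — whatever the `μ`-invariant of `L` (`L = C(c)·L₀`, the kernel of
`𝒪⟦T⟧/(L) ↠ 𝒪⟦T⟧/(L₀)` is killed by `c`, hence by a power of `p`, invisible after `ℚ_p ⊗`; `𝒪⟦T⟧/(L₀)` is free of
`ℤ_p`-rank `[E:ℚ_p]·d`). The `𝒪`-currency twin is `LambdaLowerBoundO.finrank_baseChange_quotient_span_eq_of_normLambda`.
[cite: Washington1997, §7.1 Thm. 7.3 and §13.2] -/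
theorem finrank_padic_baseChange_quotient_span_eq_mul_of_normLambda
    (L : PowerSeries (PadicIntermediateField.unitBall p E)) (d : ℕ) (hL : L ≠ 0)
    (hle : ∀ k, ‖((coeff k L : PadicIntermediateField.unitBall p E) : PadicAlgCl p)‖ ≤
      ‖((coeff d L : PadicIntermediateField.unitBall p E) : PadicAlgCl p)‖)
    (hlt : ∀ k, k < d → ‖((coeff k L : PadicIntermediateField.unitBall p E) : PadicAlgCl p)‖ <
      ‖((coeff d L : PadicIntermediateField.unitBall p E) : PadicAlgCl p)‖) :
    Module.finrank ℚ_[p] (ℚ_[p] ⊗[ℤ_[p]] (PowerSeries (PadicIntermediateField.unitBall p E) ⧸ Ideal.span {L})) =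
      Module.finrank ℚ_[p] E * d := by
  obtain ⟨L₀, hfac, hc0, hd1, hlow⟩ := exists_eq_C_mul_of_normLambda p E L d hL hle hlt
  set c := coeff d L with hc
  obtain ⟨hfreeZ, hrankZ⟩ :=
    free_finrank_padicInt_quotient_span_of_order_eq p E L₀ d (order_map_residue_eq L₀ d hd1 hlow)
  haveI := hfreeZ
  -- the surjection `Λ/(L) → Λ/(L₀)` and its `c`-torsion kernel
  have hle' : Ideal.span {L} ≤ Ideal.span {L₀} := by
    rw [Ideal.span_singleton_le_span_singleton, hfac]
    exact Dvd.intro_left _ rfl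
  let π : (PowerSeries (PadicIntermediateField.unitBall p E) ⧸ Ideal.span {L}) →ₐ[
      PadicIntermediateField.unitBall p E]
      (PowerSeries (PadicIntermediateField.unitBall p E) ⧸ Ideal.span {L₀}) :=
    Ideal.Quotient.factorₐ (PadicIntermediateField.unitBall p E) hle'
  let πZ : (PowerSeries (PadicIntermediateField.unitBall p E) ⧸ Ideal.span {L}) →ₗ[ℤ_[p]]
      (PowerSeries (PadicIntermediateField.unitBall p E) ⧸ Ideal.span {L₀}) :=
    π.toLinearMap.restrictScalars ℤ_[p]
  have hπ : Function.Surjective πZ := Ideal.Quotient.factor_surjective hle'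
  have hker : ∀ x ∈ LinearMap.ker πZ, c • x = 0 := by
    intro x hx
    obtain ⟨y, rfl⟩ := Ideal.Quotient.mk_surjective x
    rw [LinearMap.mem_ker, LinearMap.restrictScalars_apply, AlgHom.toLinearMap_apply,
      Ideal.Quotient.factorₐ_apply_mk, Ideal.Quotient.eq_zero_iff_mem, Ideal.mem_span_singleton'] at hx
    obtain ⟨z, rfl⟩ := hx
    change Ideal.Quotient.mk (Ideal.span {L}) (c • (z * L₀)) = 0
    rw [Ideal.Quotient.eq_zero_iff_mem, smul_eq_C_mul, Ideal.mem_span_singleton']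
    exact ⟨z, by rw [hfac]; ring⟩
  -- `c ∣ p^N`, so the kernel is killed by `p^N ∈ ℤ_p`, a unit of `ℚ_p`
  obtain ⟨N, e, he⟩ := exists_dvd_natCast_prime_pow p E hc0
  have hkerZ : ∀ x ∈ LinearMap.ker πZ, ((p : ℤ_[p]) ^ N) • x = 0 := by
    intro x hx
    rw [← IsScalarTower.algebraMap_smul (PadicIntermediateField.unitBall p E), map_pow, map_natCast, he,
      mul_comm, mul_smul, hker x hx, smul_zero]
  have hunit : IsUnit (algebraMap ℤ_[p] ℚ_[p] ((p : ℤ_[p]) ^ N)) := by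
    rw [isUnit_iff_ne_zero, map_pow, map_natCast]
    exact pow_ne_zero _ (Nat.cast_ne_zero.mpr (Fact.out : p.Prime).ne_zero)
  rw [finrank_baseChange_eq_of_surjective_of_smul_ker_eq_zero ℚ_[p] πZ hπ _ hunit hkerZ,
    Module.finrank_baseChange, hrankZ]

/-! ## §3. The `ℤ_p ↔ 𝒪` currency bridge for finitely generated `𝒪_E`-modules -/

/-- **`dim_{ℚ_p}(ℚ_p ⊗_{ℤ_p} M) = [E:ℚ_p]·dim_E(E ⊗_{𝒪_E} M)` for `M` finitely generated over `𝒪_E`** (with its canonical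
`ℤ_p`-structure): both sides see only `M/M_tors`, free over `𝒪_E` (PID) hence over `ℤ_p` of `[E:ℚ_p]` times the rank; the
torsion submodule is finite, so killed by its cardinality, a unit of `ℚ_p`. (For `λ`-invariants: `λ_{ℤ_p} = [E:ℚ_p]·λ_𝒪` on
`Λ_𝒪`-modules with `μ = 0`.) [cite: Washington1997, §13.2] -/
theorem finrank_padic_baseChange_eq_mul_of_moduleFinite (M : Type w) [AddCommGroup M]
    [Module (PadicIntermediateField.unitBall p E) M] [Module ℤ_[p] M]
    [IsScalarTower ℤ_[p] (PadicIntermediateField.unitBall p E) M]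
    [Module.Finite (PadicIntermediateField.unitBall p E) M] :
    Module.finrank ℚ_[p] (ℚ_[p] ⊗[ℤ_[p]] M) =
      Module.finrank ℚ_[p] E * Module.finrank E (E ⊗[PadicIntermediateField.unitBall p E] M) := by
  haveI : IsFractionRing (PadicIntermediateField.unitBall p E) E :=
    IsIntegralClosure.isFractionRing_of_finite_extension ℤ_[p] ℚ_[p] E (PadicIntermediateField.unitBall p E)
  haveI := PadicIntermediateField.isPrincipalIdealRing_unitBall p E
  set T := Submodule.torsion (PadicIntermediateField.unitBall p E) M with hT
  rw [finrank_baseChange_eq_finrank_quotientTorsion E M]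
  haveI : Module.Free (PadicIntermediateField.unitBall p E) (M ⧸ T) := Module.free_of_finite_type_torsion_free'
  haveI : Module.Free ℤ_[p] (M ⧸ T) := Module.Free.trans (S := PadicIntermediateField.unitBall p E)
  haveI : Finite T := finite_torsion_unitBall p E M
  -- `ℚ_p ⊗ M ≅ ℚ_p ⊗ (M/T)`: the kernel `T` is finite, killed by `#T ∈ ℤ_p ∖ 0`
  let πZ : M →ₗ[ℤ_[p]] (M ⧸ T) := (Submodule.mkQ T).restrictScalars ℤ_[p]
  have hπ : Function.Surjective πZ := Submodule.mkQ_surjective T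
  have hker : ∀ x ∈ LinearMap.ker πZ, ((Nat.card T : ℕ) : ℤ_[p]) • x = 0 := by
    intro x hx
    rw [LinearMap.mem_ker, LinearMap.restrictScalars_apply, Submodule.mkQ_apply, Submodule.Quotient.mk_eq_zero] at hx
    have h := card_nsmul_eq_zero' (G := T) (x := ⟨x, hx⟩)
    rw [Nat.cast_smul_eq_nsmul]
    exact congrArg Subtype.val h
  have hunit : IsUnit (algebraMap ℤ_[p] ℚ_[p] ((Nat.card T : ℕ) : ℤ_[p])) := by
    rw [isUnit_iff_ne_zero, map_natCast, Nat.cast_ne_zero]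
    exact Nat.card_pos.ne'
  rw [finrank_baseChange_eq_of_surjective_of_smul_ker_eq_zero ℚ_[p] πZ hπ _ hunit hker, Module.finrank_baseChange,
    ← Module.finrank_mul_finrank ℤ_[p] (PadicIntermediateField.unitBall p E) (M ⧸ T),
    IsIntegralClosure.rank ℤ_[p] ℚ_[p] E (PadicIntermediateField.unitBall p E)]

/-! ## §4. Every non-zero `L ∈ 𝒪_E⟦T⟧` has a norm-λ index -/

/-- **Norm-λ witness.** For `L ∈ 𝒪_E⟦T⟧`, `L ≠ 0` (`E/ℚ_p` finite): there is an index `d` at which the maximum coefficient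
norm of `L` (read in `ℚ̄_p`) is attained and before which it is not — the coefficient norms lie in the discrete set
`{‖ϖ‖ⁿ} ∪ {0}` (`𝒪_E` a DVR), so the least exponent occurs and occurs first somewhere. Port of the tree's `p = 2` witness
`ResidualThetaLayer.stub_normLambdaWitnessAtTwo`. [cite: NeukirchANT1999, Ch. II (4.8)] -/
theorem exists_normLambda_unitBall (L : PowerSeries (PadicIntermediateField.unitBall p E)) (hL : L ≠ 0) :
    ∃ d : ℕ, (∀ k, ‖((coeff k L : PadicIntermediateField.unitBall p E) : PadicAlgCl p)‖ ≤
        ‖((coeff d L : PadicIntermediateField.unitBall p E) : PadicAlgCl p)‖) ∧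
      ∀ k, k < d → ‖((coeff k L : PadicIntermediateField.unitBall p E) : PadicAlgCl p)‖ <
        ‖((coeff d L : PadicIntermediateField.unitBall p E) : PadicAlgCl p)‖ := by
  classical
  haveI : IsDiscreteValuationRing (PadicIntermediateField.unitBall p E) := isDiscreteValuationRing_unitBall p E
  obtain ⟨ϖ, hϖ⟩ := IsDiscreteValuationRing.exists_irreducible (PadicIntermediateField.unitBall p E)
  set c : ℝ := ‖(ϖ : PadicAlgCl p)‖ with hc
  have hc1 : c < 1 := (norm_lt_one_iff_not_isUnit p E ϖ).mpr hϖ.not_isUnit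
  have hc0 : 0 < c := by
    rw [hc, norm_pos_iff]
    exact fun h ↦ hϖ.ne_zero (Subtype.ext h)
  have hnormU : ∀ x : PadicIntermediateField.unitBall p E, x ≠ 0 → ∃ n : ℕ, ‖(x : PadicAlgCl p)‖ = c ^ n := by
    intro x hx
    obtain ⟨n, u, hxu⟩ := IsDiscreteValuationRing.eq_unit_mul_pow_irreducible hx hϖ
    refine ⟨n, ?_⟩
    have hu : ‖((u : PadicIntermediateField.unitBall p E) : PadicAlgCl p)‖ = 1 := by
      have h1 := PadicIntermediateField.valued_eq_one_of_isUnit p E (Units.isUnit u)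
      rw [PadicAlgCl.valuation_def] at h1
      rw [← coe_nnnorm, h1, NNReal.coe_one]
    rw [hxu, Subring.coe_mul, Subring.coe_pow, norm_mul, norm_pow, hu, one_mul]
  -- the coefficient norms `‖L_k‖`
  have hnorm : ∀ k, coeff k L ≠ 0 →
      ∃ n : ℕ, ‖((coeff k L : PadicIntermediateField.unitBall p E) : PadicAlgCl p)‖ = c ^ n := fun k hk ↦
    hnormU (coeff k L) hk
  have hex : ∃ k, coeff k L ≠ 0 := by
    by_contra h
    push Not at h
    exact hL (PowerSeries.ext fun k ↦ by rw [map_zero]; exact h k)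
  have hP : ∃ n : ℕ, ∃ k, coeff k L ≠ 0 ∧
      ‖((coeff k L : PadicIntermediateField.unitBall p E) : PadicAlgCl p)‖ = c ^ n := by
    obtain ⟨k, hk⟩ := hex
    obtain ⟨n, hn⟩ := hnorm k hk
    exact ⟨n, k, hk, hn⟩
  set n₀ := Nat.find hP with hn₀
  have hn₀spec : ∃ k, coeff k L ≠ 0 ∧
      ‖((coeff k L : PadicIntermediateField.unitBall p E) : PadicAlgCl p)‖ = c ^ n₀ := Nat.find_spec hP
  have hn₀min : ∀ k, coeff k L ≠ 0 →
      ‖((coeff k L : PadicIntermediateField.unitBall p E) : PadicAlgCl p)‖ ≤ c ^ n₀ := by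
    intro k hk
    obtain ⟨n, hn⟩ := hnorm k hk
    have hle : n₀ ≤ n := Nat.find_min' hP ⟨k, hk, hn⟩
    rw [hn]
    exact pow_le_pow_of_le_one hc0.le hc1.le hle
  have hzero : ∀ k, coeff k L = 0 → ‖((coeff k L : PadicIntermediateField.unitBall p E) : PadicAlgCl p)‖ = 0 :=
    fun k hk ↦ by rw [hk, ZeroMemClass.coe_zero, norm_zero]
  set d := Nat.find hn₀spec with hd
  obtain ⟨hd0, hdn⟩ := (Nat.find_spec hn₀spec : coeff d L ≠ 0 ∧
    ‖((coeff d L : PadicIntermediateField.unitBall p E) : PadicAlgCl p)‖ = c ^ n₀)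
  refine ⟨d, fun k ↦ ?_, fun k hk ↦ ?_⟩
  · rw [hdn]
    by_cases hk : coeff k L = 0
    · rw [hzero k hk]; exact pow_nonneg hc0.le _
    · exact hn₀min k hk
  · rw [hdn]
    by_cases hk0 : coeff k L = 0
    · rw [hzero k hk0]; exact pow_pos hc0 _
    · obtain ⟨n, hn⟩ := hnorm k hk0
      have hle : n₀ ≤ n := Nat.find_min' hP ⟨k, hk0, hn⟩
      have hne : n ≠ n₀ := fun h ↦ Nat.find_min hn₀spec hk ⟨hk0, by rw [hn, h]⟩
      rw [hn]
      exact pow_lt_pow_right_of_lt_one₀ hc0 hc1 (lt_of_le_of_ne hle (Ne.symm hne))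

omit [FiniteDimensional ℚ_[p] E] in
/-- **Norm-λ witness on the crux's carriers**: for `𝒪 = padicCoeffIntegers S` with `ℚ_p(S)/ℚ_p` finite and `L ∈ Λ_𝒪 =
IwasawaAlgebraO S`, `L ≠ 0`, there is a `d` satisfying the two norm clauses of the E2-tail on `iwasawaOToPowerSeries S L`
(any `p`; the `∃ d` of `stub_charRoad_ns`). [cite: NeukirchANT1999, Ch. II (4.8)] -/
theorem exists_normLambda_iwasawaAlgebraO (S : Set (PadicAlgCl p))
    [FiniteDimensional ℚ_[p] (Literature.NumberTheory.EllipticCurves.padicCoeffField S)] :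
    ∀ (L : Literature.NumberTheory.EllipticCurves.IwasawaAlgebraO S), L ≠ 0 →
      ∃ d : ℕ, (∀ k : ℕ, ‖coeff k (Literature.NumberTheory.EllipticCurves.iwasawaOToPowerSeries S L)‖ ≤
          ‖coeff d (Literature.NumberTheory.EllipticCurves.iwasawaOToPowerSeries S L)‖) ∧
        ∀ k : ℕ, k < d → ‖coeff k (Literature.NumberTheory.EllipticCurves.iwasawaOToPowerSeries S L)‖ <
          ‖coeff d (Literature.NumberTheory.EllipticCurves.iwasawaOToPowerSeries S L)‖ := by
  simp only [Literature.NumberTheory.EllipticCurves.coeff_iwasawaOToPowerSeries]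
  unfold Literature.NumberTheory.EllipticCurves.IwasawaAlgebraO
  rw [Literature.NumberTheory.EllipticCurves.padicCoeffIntegers_eq_unitBall S]
  intro L hL
  exact exists_normLambda_unitBall p _ L hL

end Summit.BirchSwinnertonDyer.BirchSwinnertonDyer.Theorems.SmallImageRttE2Num

end
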